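import Mathlib.Algebra.BigOperators.Fin
import Literature.Computability.AlgebraicComplexity.LaserMethodBigCW
import Summits.MatrixMultiplication.MatrixMultiplication.Theorems.SaturationLadderTwinCW
import HarnessLib

/-!
# SaturationLadder — the twin tensor `TW_b`: coarse levels, component formats and matrices

Route `SaturationLadder` (sub-problem `MatrixMultiplication`), support for the aside
`TwinSaturation` (stmt-MatrixMultiplication-30539); second of three files.  The COARSE levels
`levX, levZ : TwIdx b → Fin 3` (unit / linear / socle; the two copies `x′, x″` of the linear forms
share level `1`) put the support of the twin Coppersmith–Winograd tensor `TW_b`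
(`Theorems/SaturationLadderTwinCW.lean`) inside the Coppersmith–Winograd set
`cwSupport₃ = {i+j+l = 2}` (`twTensor_mem_support`) — so `TW_b` has the same tightness and the same
free-diagonal extraction as `CW_q` (`exists_free_diagonal_jointType_card` applies verbatim).  Its
six components restrict to matrix tensors of formats `twFmtK/M/N`
(`(1,1,0) ↦ ⟨b,2,1⟩`, `(0,1,1) ↦ ⟨1,2b,1⟩`, `(1,0,1) ↦ ⟨1,1,2b⟩`, `(0,2,0) ↦ ⟨1,2,1⟩`,
`(2,0,0) ↦ ⟨1,1,2⟩`, `(0,0,2) ↦ ⟨1,1,1⟩`; index convention of `matMulTensor`) through the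
block-supported matrices `twMI/twMJ/twML`: five of them on coordinates, and the quadratic letter
`(1,1,0) = ∑ᵢ (x′ᵢ y′ᵢ z_{s₁} + x″ᵢ y″ᵢ z_{s₂})` through the LINEAR identification `xᵢ ↦ x′ᵢ + x″ᵢ`
(`twTensor_component`).  (A refined four-level blocking separating `x′` from `x″` is NOT tight,
and a global identification `x′ᵢ, x″ᵢ ↦ xᵢ` before extraction halves the `(1,0,1)`-capacity; the
coarse levels with a linear identification inside the `(1,1,0)`-blocks avoid both losses.)  The
third file feeds these data into the linear form of BCS Prop. 15.30
(`Theorems/SaturationLadderLinearRestriction.lean`).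

References: Bürgisser–Clausen–Shokrollahi (1997) §15.6–15.7 [BurgisserClausenShokrollahi1997];
D. Coppersmith, S. Winograd, J. Symb. Comput. 9 (1990) §6 [CoppersmithWinograd1990].
-/

noncomputable section

open scoped BigOperators
open Finset Literature.Computability.AlgebraicComplexity

namespace Summit.MatrixMultiplication.MatrixMultiplication.Theorems.SaturationLadderTwinComponents

universe u

variable {K : Type u} [CommSemiring K]

section TwinData

open Summit.MatrixMultiplication.MatrixMultiplication.Theorems.SaturationLadderTwinCW
open Summit.MatrixMultiplication.MatrixMultiplication.Theorems.SaturationLadderTwinCW.TwIdx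

variable (b : ℕ)

/-- `x`- (and `y`-) level of a basis element of `TW_b`: unit `0`, linear forms `1`, socle `2`. [folklore] -/
def levX : TwIdx b → Fin 3
  | unit => 0
  | fst _ => 1
  | snd _ => 1
  | soc₁ => 2
  | soc₂ => 2

/-- `z`-level (output side, reversed so that the support is `{i+j+l = 2}`): unit `2`, linear `1`,
socle `0`. [folklore] -/
def levZ : TwIdx b → Fin 3
  | unit => 2
  | fst _ => 1
  | snd _ => 1
  | soc₁ => 0
  | soc₂ => 0

/-- The first-copy linear form with digit `d` (junk `unit` out of range). [folklore] -/
def fstOf (d : ℕ) : TwIdx b := if h : d < b then fst ⟨d, h⟩ else unit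

/-- The second-copy linear form with digit `d` (junk `unit` out of range). [folklore] -/
def sndOf (d : ℕ) : TwIdx b := if h : d < b then snd ⟨d, h⟩ else unit

/-- The linear form with digit `d < 2b`: `fst d` for `d < b`, `snd (d - b)` for `b ≤ d < 2b`
(junk `unit` out of range). [folklore] -/
def linOf (d : ℕ) : TwIdx b :=
  if h : d < b then fst ⟨d, h⟩ else if h' : d - b < b then snd ⟨d - b, h'⟩ else unit

/-- The socle element with digit `d`: `soc₁` for `d = 0`, else `soc₂`. [folklore] -/
def socOf (d : ℕ) : TwIdx b := if d = 0 then soc₁ else soc₂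

/-- Formats `k` of the components of `TW_b` (index convention of `matMulTensor`: `x = (κ,ν)`,
`y = (κ,μ)`, `z = (μ,ν)`): `k = b` for the quadratic letter `(1,1,0)` (`x_i (y′_i z_{s₁} + y″_i z_{s₂})`
after the identification `x′_i, x″_i ↦ x_i`), else `1`. [folklore] -/
def twFmtK (s : Fin 3 × Fin 3 × Fin 3) : ℕ := if s = (1, 1, 0) then b else 1

/-- Formats `m`: `2b` for `(0,1,1) = x₀ y_a z_a`, `2` for `(1,1,0)` (the two socle outputs) and for
`(0,2,0) = x₀ y_{s_j} z_{s_j}`, else `1` — written as a product of one-letter factors. [folklore] -/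
def twFmtM (s : Fin 3 × Fin 3 × Fin 3) : ℕ :=
  (if s = (0, 1, 1) then b + b else 1) * (if s = (1, 1, 0) then 2 else 1) * (if s = (0, 2, 0) then 2 else 1)

/-- Formats `n`: `2b` for `(1,0,1) = x_a y₀ z_a`, `2` for `(2,0,0) = x_{s_j} y₀ z_{s_j}`, else `1`. [folklore] -/
def twFmtN (s : Fin 3 × Fin 3 × Fin 3) : ℕ :=
  (if s = (1, 0, 1) then b + b else 1) * (if s = (2, 0, 0) then 2 else 1)

/-- First `x`-index of the component `s` at digits `(κ, ν)`. [folklore] -/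
def twXIdx (s : Fin 3 × Fin 3 × Fin 3) (κ ν : ℕ) : TwIdx b :=
  if s.1 = 0 then unit else if s.1 = 2 then socOf b (κ + ν)
  else if s.2.1 = 1 then fstOf b (κ + ν) else linOf b (κ + ν)

/-- Second `x`-index of the quadratic component (the identified partner `x″_κ`). [folklore] -/
def twXIdx' (κ ν : ℕ) : TwIdx b := sndOf b (κ + ν)

/-- `y`-index of the component `s` at digits `(κ, μ)`. [folklore] -/
def twYIdx (s : Fin 3 × Fin 3 × Fin 3) (κ μ : ℕ) : TwIdx b :=
  if s.2.1 = 0 then unit else if s.2.1 = 2 then socOf b (κ + μ)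
  else if s.1 = 1 then (if μ = 0 then fstOf b κ else sndOf b κ) else linOf b (κ + μ)

/-- `z`-index of the component `s` at digits `(μ, ν)`. [folklore] -/
def twZIdx (s : Fin 3 × Fin 3 × Fin 3) (μ ν : ℕ) : TwIdx b :=
  if s.2.2 = 2 then unit else if s.2.2 = 0 then socOf b (μ + ν) else linOf b (μ + ν)

variable (K)

/-- Component matrix on the `x` side: the row of the matrix index `u` is the indicator of
`twXIdx`, plus — for the quadratic letter only — the indicator of the partner `twXIdx'`
(the identification `x_κ ↦ x′_κ + x″_κ`). [folklore] -/
def twMI (s : Fin 3 × Fin 3 × Fin 3) (u : Fin (twFmtK b s) × Fin (twFmtN b s)) (a : TwIdx b) : K :=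
  (if a = twXIdx b s u.1 u.2 then 1 else 0) +
    (if s = (1, 1, 0) then (if a = twXIdx' b u.1 u.2 then 1 else 0) else 0)

/-- Component matrix on the `y` side (indicator of `twYIdx`). [folklore] -/
def twMJ (s : Fin 3 × Fin 3 × Fin 3) (v : Fin (twFmtK b s) × Fin (twFmtM b s)) (c : TwIdx b) : K :=
  if c = twYIdx b s v.1 v.2 then 1 else 0

/-- Component matrix on the `z` side (indicator of `twZIdx`). [folklore] -/
def twML (s : Fin 3 × Fin 3 × Fin 3) (w : Fin (twFmtM b s) × Fin (twFmtN b s)) (c : TwIdx b) : K :=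
  if c = twZIdx b s w.1 w.2 then 1 else 0

variable {K b}

/-- Entries of `TW_b`. [folklore] -/
theorem twTensor_apply' (x y z : TwIdx b) :
    twTensor K b x y z = if twMul x y = some z then 1 else 0 := rfl

/-- **The `D`-support of `TW_b` lies in `{i + j + l = 2}`** (the same support as `CW_q`). [folklore] -/
theorem twTensor_mem_support {x y z : TwIdx b} (h : twTensor K b x y z ≠ 0) :
    (levX b x, levX b y, levZ b z) ∈ cwSupport₃ := by
  rw [twTensor_apply'] at h
  have h' : twMul x y = some z := by
    by_contra hc
    exact h (if_neg hc)
  rw [mem_cwSupport₃]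
  cases x <;> cases y <;> cases z <;> simp_all [twMul, levX, levZ]

/-- Collapsing the `y`- and `z`-sums against indicator rows. [folklore] -/
theorem sum_indicator_collapse {α β γ : Type*} [Fintype α] [Fintype β] [Fintype γ] [DecidableEq β]
    [DecidableEq γ] (M : α → K) (y₀ : β) (z₀ : γ) (t : α → β → γ → K) :
    ∑ a, ∑ y, ∑ z, M a * (if y = y₀ then 1 else 0) * (if z = z₀ then 1 else 0) * t a y z =
      ∑ a, M a * t a y₀ z₀ := by
  refine Finset.sum_congr rfl fun a _ => ?_
  rw [Finset.sum_eq_single y₀, Finset.sum_eq_single z₀]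
  · simp
  · intro z _ hz; simp [hz]
  · simp
  · intro y _ hy; simp [hy]
  · simp

/-- The `x`-sum against the (one- or two-term) row `twMI`. [folklore] -/
theorem sum_twMI_mul (s : Fin 3 × Fin 3 × Fin 3) (u : Fin (twFmtK b s) × Fin (twFmtN b s))
    (F : TwIdx b → K) :
    ∑ a, twMI K b s u a * F a =
      F (twXIdx b s u.1 u.2) + if s = (1, 1, 0) then F (twXIdx' b u.1 u.2) else 0 := by
  simp only [twMI, add_mul, Finset.sum_add_distrib, ite_mul, one_mul, zero_mul,
    Finset.sum_ite_eq', Finset.mem_univ, if_true]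
  by_cases hs : s = (1, 1, 0)
  · simp [hs]
  · simp [hs]

/-- **The components of `TW_b` restrict to the matrix tensors `⟨twFmtK, twFmtM, twFmtN⟩`** through
the matrices `twMI, twMJ, twML`: `(0,1,1) ≃ ⟨1,2b,1⟩`, `(1,0,1) ≃ ⟨1,1,2b⟩`, `(0,2,0) ≃ ⟨1,2,1⟩`,
`(2,0,0) ≃ ⟨1,1,2⟩`, `(0,0,2) ≃ ⟨1,1,1⟩` on coordinates, and the quadratic letter
`(1,1,0) = ∑ᵢ (x′ᵢ y′ᵢ z_{s₁} + x″ᵢ y″ᵢ z_{s₂}) ≥ ⟨b,2,1⟩` through `xᵢ ↦ x′ᵢ + x″ᵢ`. [folklore] -/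
theorem twTensor_component (s : Fin 3 × Fin 3 × Fin 3) (hs : s ∈ cwSupport₃)
    (u : Fin (twFmtK b s) × Fin (twFmtN b s)) (v : Fin (twFmtK b s) × Fin (twFmtM b s))
    (w : Fin (twFmtM b s) × Fin (twFmtN b s)) :
    ∑ a, ∑ y, ∑ z, twMI K b s u a * twMJ K b s v y * twML K b s w z * twTensor K b a y z =
      matMulTensor K (twFmtK b s) (twFmtM b s) (twFmtN b s) u v w := by
  have hcol := sum_indicator_collapse (twMI K b s u) (twYIdx b s v.1 v.2) (twZIdx b s w.1 w.2)
    (twTensor K b)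
  simp only [twMJ, twML] at hcol ⊢
  rw [hcol, sum_twMI_mul]
  have hu1 := u.1.isLt; have hu2 := u.2.isLt; have hv1 := v.1.isLt; have hv2 := v.2.isLt
  have hw1 := w.1.isLt; have hw2 := w.2.isLt
  rw [mem_cwSupport₃_iff] at hs
  rcases hs with rfl | rfl | rfl | rfl | rfl | rfl
  · -- `(0,1,1)`: `⟨1, 2b, 1⟩`, entry `[v.2 = w.1]`
    simp only [twFmtK, twFmtM, twFmtN] at hu1 hu2 hv1 hv2 hw1 hw2
    norm_num at hu1 hu2 hv1 hv2 hw1 hw2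
    simp only [twXIdx, twYIdx, twZIdx, matMulTensor, twTensor_apply', Fin.ext_iff]
    norm_num
    by_cases h1 : (v.2 : ℕ) < b <;> by_cases h2 : (w.1 : ℕ) < b
    · simp [linOf, twMul, h1, h2, Fin.ext_iff]
    · have h2' : (w.1 : ℕ) - b < b := by omega
      have hne : (v.2 : ℕ) ≠ w.1 := by omega
      simp only [linOf, twMul, dif_pos h1, dif_neg h2, dif_pos h2']
      simp [hne]
    · have h1' : (v.2 : ℕ) - b < b := by omega
      have hne : (v.2 : ℕ) ≠ w.1 := by omega
      simp only [linOf, twMul, dif_neg h1, dif_pos h1', dif_pos h2]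
      simp [hne]
    · have h1' : (v.2 : ℕ) - b < b := by omega
      have h2' : (w.1 : ℕ) - b < b := by omega
      have heq : ((v.2 : ℕ) - b = w.1 - b) ↔ ((v.2 : ℕ) = w.1) := by omega
      simp only [linOf, twMul, dif_neg h1, dif_pos h1', dif_neg h2, dif_pos h2']
      simp [Fin.ext_iff, heq]
  · -- `(1,0,1)`: `⟨1, 1, 2b⟩`, entry `[u.2 = w.2]`
    simp only [twFmtK, twFmtM, twFmtN] at hu1 hu2 hv1 hv2 hw1 hw2
    norm_num at hu1 hu2 hv1 hv2 hw1 hw2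
    simp only [twXIdx, twYIdx, twZIdx, matMulTensor, twTensor_apply', Fin.ext_iff]
    norm_num
    by_cases h1 : (u.2 : ℕ) < b <;> by_cases h2 : (w.2 : ℕ) < b
    · simp [linOf, twMul, h1, h2, Fin.ext_iff]
    · have h2' : (w.2 : ℕ) - b < b := by omega
      have hne : (u.2 : ℕ) ≠ w.2 := by omega
      simp only [linOf, twMul, dif_pos h1, dif_neg h2, dif_pos h2']
      simp [hne]
    · have h1' : (u.2 : ℕ) - b < b := by omega
      have hne : (u.2 : ℕ) ≠ w.2 := by omega
      simp only [linOf, twMul, dif_neg h1, dif_pos h1', dif_pos h2]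
      simp [hne]
    · have h1' : (u.2 : ℕ) - b < b := by omega
      have h2' : (w.2 : ℕ) - b < b := by omega
      have heq : ((u.2 : ℕ) - b = w.2 - b) ↔ ((u.2 : ℕ) = w.2) := by omega
      simp only [linOf, twMul, dif_neg h1, dif_pos h1', dif_neg h2, dif_pos h2']
      simp [Fin.ext_iff, heq]
  · -- `(1,1,0)`: `⟨b, 2, 1⟩` through `x_κ ↦ x′_κ + x″_κ`, entry `[u.1 = v.1 ∧ v.2 = w.1]`
    simp only [twFmtK, twFmtM, twFmtN] at hu1 hu2 hv1 hv2 hw1 hw2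
    norm_num at hu1 hu2 hv1 hv2 hw1 hw2
    simp only [twXIdx, twXIdx', twYIdx, twZIdx, matMulTensor, twTensor_apply', Fin.ext_iff]
    norm_num
    simp only [fstOf, sndOf, socOf, twMul, dif_pos hu1, dif_pos hv1]
    have hv0 : (v.2 : ℕ) = 0 ∨ (v.2 : ℕ) = 1 := by omega
    have hw0 : (w.1 : ℕ) = 0 ∨ (w.1 : ℕ) = 1 := by omega
    rcases hv0 with hv0 | hv0 <;> rcases hw0 with hw0 | hw0 <;> by_cases huv : u.1 = v.1
    all_goals first
      | (have huvv : (u.1 : ℕ) = v.1 := by rw [huv]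
         simp [hv0, hw0, huv])
      | (have huvv : (u.1 : ℕ) ≠ v.1 := fun h => huv (Fin.ext h)
         simp [hv0, hw0, huvv] <;> exact fun h => absurd h huv)
  · -- `(2,0,0)`: `⟨1, 1, 2⟩`, entry `[u.2 = w.2]`
    simp only [twFmtK, twFmtM, twFmtN] at hu1 hu2 hv1 hv2 hw1 hw2
    norm_num at hu1 hu2 hv1 hv2 hw1 hw2
    simp only [twXIdx, twYIdx, twZIdx, matMulTensor, twTensor_apply', Fin.ext_iff]
    norm_num
    simp only [socOf, twMul]
    have ha : (u.2 : ℕ) = 0 ∨ (u.2 : ℕ) = 1 := by omega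
    have hc : (w.2 : ℕ) = 0 ∨ (w.2 : ℕ) = 1 := by omega
    rcases ha with ha | ha <;> rcases hc with hc | hc <;> simp [ha, hc]
  · -- `(0,2,0)`: `⟨1, 2, 1⟩`, entry `[v.2 = w.1]`
    simp only [twFmtK, twFmtM, twFmtN] at hu1 hu2 hv1 hv2 hw1 hw2
    norm_num at hu1 hu2 hv1 hv2 hw1 hw2
    simp only [twXIdx, twYIdx, twZIdx, matMulTensor, twTensor_apply', Fin.ext_iff]
    norm_num
    simp only [socOf, twMul]
    have ha : (v.2 : ℕ) = 0 ∨ (v.2 : ℕ) = 1 := by omega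
    have hc : (w.1 : ℕ) = 0 ∨ (w.1 : ℕ) = 1 := by omega
    rcases ha with ha | ha <;> rcases hc with hc | hc <;> simp [ha, hc]
  · -- `(0,0,2)`: `⟨1, 1, 1⟩`, entry `1`
    simp only [twFmtK, twFmtM, twFmtN] at hu1 hu2 hv1 hv2 hw1 hw2
    norm_num at hu1 hu2 hv1 hv2 hw1 hw2
    simp only [twXIdx, twYIdx, twZIdx, matMulTensor, twTensor_apply', Fin.ext_iff]
    norm_num
    simp [twMul]

end TwinData

end Summit.MatrixMultiplication.MatrixMultiplication.Theorems.SaturationLadderTwinComponents
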